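import Summits.SmoothPoincare4.SmoothPoincare4.Theses.EinsteinBulk
import Summits.SmoothPoincare4.SmoothPoincare4.Theorems.InformationMetricHadamardAhHadamardFillingStubInteriorConnected
import Literature.Geometry.Riemannian.SimpleAHBoundarySphereConvexInput

/-!
# `EinsteinHadamardFillingStandard` (item 7999) and `HadamardFillingStandard` (item 8000) from two pieces (route EinsteinBulk)

THE DECOMPOSITION (crux-strategist, BC2 redirect). The recogniser crux
`EinsteinBulk.EinsteinHadamardFillingStandard` — a closed smooth `M ≃ₕ S⁴` which is the conformal
infinity of a `C²`-conformally compact Einstein `5`-manifold `(N, g)` with `K ≤ 0` is diffeomorphic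
to `S⁴` — follows from two strictly smaller statements, neither of which mentions a diffeomorphism
`M ≅ S⁴`:

* `CompactificationConvexNearInfinity` — CONVEXITY NEAR INFINITY AT `C²` COMPACTIFIED REGULARITY
  (GGSU 2019, p. 10, "the regions `{ρ ≥ ε}` are strictly convex for `ε > 0` small"; here with the
  compactified metric `ḡ` only `C²`, no curvature sign, no Einstein equation, no hypothesis on the
  boundary): along unit speed `g`-geodesics, `ρ ∘ j` has no interior minimum below some `ε₀ > 0`;
* `HadamardFillingNonTrapping` — NON-TRAPPING OF HADAMARD FILLINGS OF HOMOTOPY `4`-SPHERES: a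
  `C²`-conformally compact `(N, g)` with `K ≤ 0` whose conformal boundary is a homotopy `4`-sphere
  has no trapped geodesics (every non-constant geodesic leaves every compact set; GGSU p. 10:
  non-trapping forces `π₁ = 1`, and conversely here `π₁(N) = 1` comes from the simply connected
  boundary through the Cartan–Hadamard covering).

THE ASSEMBLY is the tree's Graham–Guillarmou–Stefanov–Uhlmann corollary with the convexity input
abstracted and any compactified regularity
(`Literature.Geometry.Riemannian.SimpleAH.boundary_sphere_of_convex_of_nonTrapping_of_nonpos`,
`SimpleAHBoundarySphereConvexInput.lean`, p140982 — itself the landed discharge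
`ggsu_boundary_sphere_of_nonTrapping_of_nonpos_holds` re-run with the convexity threshold as a
hypothesis: completeness, Cartan–Hadamard covering `exp_p`, exit structure of the rays, injectivity
of `exp_p` from the saturated star-shaped ball, Milnor's collar along `ρ`) at `m = 3`, `k = 2`,
`B = M`: its convexity hypothesis is the first piece, its non-trapping hypothesis the second;
`ConnectedSpace N` comes from the landed `stub_interiorConnected` (interior of a compact connected
`5`-manifold with boundary) and a collar point (`SimpleAH.exists_openCollarData_of_bdf`, `M`
nonempty as `M ≃ₕ S⁴`). The Einstein equation and the conformal-infinity clause `ι^*ḡ = φ g₀` of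
the crux are not used.

Everything here is proved (no `sorry`, no definition, no named fact).

References: C. R. Graham, C. Guillarmou, P. Stefanov, G. Uhlmann, Ann. Inst. Fourier 69 (2019),
Prop. 5.13, Def. 5.3 and remark, p. 3, p. 10 [GrahamEtAl2020]; R. Mazzeo, J. Diff. Geom. 28 (1988)
§1; J. M. Lee, *Introduction to Riemannian Manifolds* (2018), Thm. 12.8 [Lee2018]; J. Milnor,
*Lectures on the h-cobordism theorem* (1965), Thm. 3.4.
-/

noncomputable section

-- the prescribed namespace `Summit.<P>.<Sub>.…` duplicates `SmoothPoincare4` (P = Sub)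
set_option linter.dupNamespace false

open Bundle Set Filter Function Metric TopologicalSpace
open scoped Manifold ContDiff Topology ContinuousMap

namespace Summit.SmoothPoincare4.SmoothPoincare4.Cruxes.EinsteinHadamardFillingStandard.GgsuC2Redirect

open Literature.Geometry.Lorentzian Literature.Geometry.Lorentzian.PseudoRiemannianMetric
  Literature.Geometry.Riemannian Literature.Geometry.Riemannian.SimpleAH
  Literature.Topology.FourManifolds

set_option maxSynthPendingDepth 3 in
set_option maxHeartbeats 800000 in
/-- **`HadamardFillingStandard` (item stmt-SmoothPoincare4-8000, no Einstein equation) from convexity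
near infinity at `C²` and non-trapping**
(the GGSU corollary, Ann. Inst. Fourier 69 (2019), Prop. 5.13 with the remark after Def. 5.3,
re-run at `C²` compactified regularity with its two geometric inputs as hypotheses): if (1) every
`C²`-conformally compact `5`-manifold is convex near infinity and (2) every `C²`-conformally compact
`K ≤ 0` filling of a homotopy `4`-sphere is non-trapping, then every such Einstein filling has
standard boundary. [cite: GrahamEtAl2020, Prop. 5.13] -/
theorem hadamardFillingStandard_of_pieces
    (hconvex : ∀ (N : Type) [TopologicalSpace N] [T2Space N] [SecondCountableTopology N]
      [ChartedSpace (EuclideanSpace ℝ (Fin 5)) N] [IsManifold (𝓡 5) ∞ N]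
      (g : Bundle.ContMDiffRiemannianMetric (𝓡 5) ∞ (EuclideanSpace ℝ (Fin 5))
        (TangentSpace (𝓡 5) : N → Type _))
      [(Literature.Geometry.Lorentzian.PseudoRiemannianMetric.ofRiemannian g).HasLeviCivita]
      (X : Type) [TopologicalSpace X] [T2Space X] [SecondCountableTopology X]
      [ChartedSpace (EuclideanHalfSpace 5) X] [IsManifold (𝓡∂ 5) ∞ X] [CompactSpace X]
      (j : N → X) (ρ : X → ℝ)
      (gb : Bundle.ContMDiffRiemannianMetric (𝓡∂ 5) 2 (EuclideanSpace ℝ (Fin 5))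
        (TangentSpace (𝓡∂ 5) : X → Type _)),
      Manifold.IsSmoothEmbedding (𝓡 5) (𝓡∂ 5) ∞ j → Set.range j = (𝓡∂ 5).interior X →
      ContMDiff (𝓡∂ 5) 𝓘(ℝ, ℝ) ∞ ρ → (∀ x : X, 0 ≤ ρ x) →
      (∀ x : X, ρ x = 0 ↔ x ∈ (𝓡∂ 5).boundary X) →
      (∀ z : X, z ∈ (𝓡∂ 5).boundary X → ∃ ν : TangentSpace (𝓡∂ 5) z, gb.inner z ν ν = 1 ∧
        ∀ v : TangentSpace (𝓡∂ 5) z, gb.inner z ν v = mfderiv (𝓡∂ 5) 𝓘(ℝ, ℝ) ρ z v) →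
      (∀ (x : N) (v w : TangentSpace (𝓡 5) x),
        gb.inner (j x) (mfderiv (𝓡 5) (𝓡∂ 5) j x v) (mfderiv (𝓡 5) (𝓡∂ 5) j x w) =
          ρ (j x) ^ 2 * g.inner x v w) →
      ∃ ε₀ : ℝ, 0 < ε₀ ∧ ∀ γ : ℝ → N,
        Literature.Geometry.Lorentzian.IsGeodesic
          (Literature.Geometry.Lorentzian.PseudoRiemannianMetric.ofRiemannian g).leviCivita γ →
        ∀ t₀ : ℝ, g.inner (γ t₀) (Literature.Geometry.Lorentzian.velocity (𝓡 5) γ t₀)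
            (Literature.Geometry.Lorentzian.velocity (𝓡 5) γ t₀) = 1 →
          ρ (j (γ t₀)) < ε₀ → deriv (fun t ↦ ρ (j (γ t))) t₀ = 0 →
          deriv (deriv fun t ↦ ρ (j (γ t))) t₀ < 0)
    (hNT : ∀ (M : Type) [TopologicalSpace M] [T2Space M] [SecondCountableTopology M]
      [ChartedSpace (EuclideanSpace ℝ (Fin 4)) M] [IsManifold (𝓡 4) ∞ M] [CompactSpace M],
      M ≃ₕ Metric.sphere (0 : EuclideanSpace ℝ (Fin 5)) 1 →
      ∀ (N : Type) [TopologicalSpace N] [T2Space N] [SecondCountableTopology N]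
        [ChartedSpace (EuclideanSpace ℝ (Fin 5)) N] [IsManifold (𝓡 5) ∞ N]
        (g : Bundle.ContMDiffRiemannianMetric (𝓡 5) ∞ (EuclideanSpace ℝ (Fin 5))
          (TangentSpace (𝓡 5) : N → Type _))
        [(Literature.Geometry.Lorentzian.PseudoRiemannianMetric.ofRiemannian g).HasLeviCivita],
        (∃ (X : Type) (_ : TopologicalSpace X) (_ : T2Space X) (_ : SecondCountableTopology X)
            (_ : ChartedSpace (EuclideanHalfSpace 5) X) (_ : IsManifold (𝓡∂ 5) ∞ X)
            (_ : CompactSpace X) (_ : ConnectedSpace X) (j : N → X) (ι : M → X) (ρ : X → ℝ)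
            (gb : Bundle.ContMDiffRiemannianMetric (𝓡∂ 5) 2 (EuclideanSpace ℝ (Fin 5))
              (TangentSpace (𝓡∂ 5) : X → Type _)),
            Manifold.IsSmoothEmbedding (𝓡 5) (𝓡∂ 5) ∞ j ∧ Set.range j = (𝓡∂ 5).interior X ∧
            Manifold.IsSmoothEmbedding (𝓡 4) (𝓡∂ 5) ∞ ι ∧ Set.range ι = (𝓡∂ 5).boundary X ∧
            ContMDiff (𝓡∂ 5) 𝓘(ℝ, ℝ) ∞ ρ ∧ (∀ x : X, 0 ≤ ρ x) ∧
            (∀ x : X, ρ x = 0 ↔ x ∈ (𝓡∂ 5).boundary X) ∧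
            (∀ y : M, ∃ ν : TangentSpace (𝓡∂ 5) (ι y), gb.inner (ι y) ν ν = 1 ∧
              ∀ v : TangentSpace (𝓡∂ 5) (ι y),
                gb.inner (ι y) ν v = mfderiv (𝓡∂ 5) 𝓘(ℝ, ℝ) ρ (ι y) v) ∧
            (∀ (x : N) (v w : TangentSpace (𝓡 5) x),
              gb.inner (j x) (mfderiv (𝓡 5) (𝓡∂ 5) j x v) (mfderiv (𝓡 5) (𝓡∂ 5) j x w) =
                ρ (j x) ^ 2 * g.inner x v w)) →
        (∀ (x : N) (X Y : TangentSpace (𝓡 5) x), g.inner x X X = 1 → g.inner x Y Y = 1 →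
            g.inner x X Y = 0 →
            (Literature.Geometry.Lorentzian.PseudoRiemannianMetric.ofRiemannian g).curvatureForm
              (Literature.Geometry.Lorentzian.PseudoRiemannianMetric.ofRiemannian g).leviCivita
                x X Y Y X ≤ 0) →
        ∀ γ : ℝ → N,
          Literature.Geometry.Lorentzian.IsGeodesic
            (Literature.Geometry.Lorentzian.PseudoRiemannianMetric.ofRiemannian g).leviCivita γ →
          Literature.Geometry.Lorentzian.velocity (𝓡 5) γ 0 ≠ 0 →
          ∀ K : Set N, IsCompact K → ∃ T : ℝ, ∀ t : ℝ, T ≤ t → γ t ∉ K) :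
    _root_.Summit.SmoothPoincare4.SmoothPoincare4.Theses.EinsteinBulk.HadamardFillingStandard := by
  intro M _ _ _ _ _ _ _ _ _ he g₀ N _ _ _ _ _ g _ hpack hsec
  obtain ⟨X, i₁, i₂, i₃, i₄, i₅, i₆, i₇, j, ι, ρ, gb, hj, hjr, hι, hιr, hρs, hρ0, hρb, hν, hconf, hφ⟩ :=
    hpack
  -- the two pieces, instantiated
  have hNT' : ∀ γ : ℝ → N, IsGeodesic (PseudoRiemannianMetric.ofRiemannian g).leviCivita γ →
      velocity (𝓡 5) γ 0 ≠ 0 → ∀ K : Set N, IsCompact K → ∃ T : ℝ, ∀ t : ℝ, T ≤ t → γ t ∉ K :=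
    hNT M he N g ⟨X, i₁, i₂, i₃, i₄, i₅, i₆, i₇, j, ι, ρ, gb, hj, hjr, hι, hιr, hρs, hρ0, hρb, hν,
      hconf⟩ hsec
  have hνz : ∀ z : X, z ∈ (𝓡∂ 5).boundary X → ∃ ν : TangentSpace (𝓡∂ 5) z, gb.inner z ν ν = 1 ∧
      ∀ v : TangentSpace (𝓡∂ 5) z, gb.inner z ν v = mfderiv (𝓡∂ 5) 𝓘(ℝ, ℝ) ρ z v := by
    intro z hz
    rw [← hιr] at hz
    obtain ⟨y, rfl⟩ := hz
    exact hν y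
  obtain ⟨ε₀, hε₀, hconv⟩ := hconvex N g X j ρ gb hj hjr hρs hρ0 hρb hνz hconf
  -- `M` is nonempty (it is homotopy equivalent to `S⁴`); Milnor's collar of `∂X` along `ρ`
  haveI hMne : Nonempty M := by
    obtain ⟨s, hs⟩ := (NormedSpace.sphere_nonempty (x := (0 : EuclideanSpace ℝ (Fin 5)))
      (r := 1)).2 zero_le_one
    exact ⟨he.invFun ⟨s, hs⟩⟩
  set b : BoundaryData (𝓡∂ 5) X (𝓡 4) :=
    { carrier := M, incl := ι, isSmoothEmbedding := hι, range_incl := hιr } with hb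
  have hreg : ∀ z, ρ z = 0 → mfderiv (𝓡∂ 5) 𝓘(ℝ, ℝ) ρ z ≠ 0 := by
    intro z hz h0
    have hzb : z ∈ (𝓡∂ 5).boundary X := (hρb z).1 hz
    rw [← hιr] at hzb
    obtain ⟨y, rfl⟩ := hzb
    obtain ⟨ν, hν1, hν2⟩ := hν y
    have h1 := hν2 ν
    rw [h0, hν1] at h1
    have h2 : (1 : ℝ) = 0 := h1
    exact one_ne_zero h2
  obtain ⟨a, c, ha, hcreg, hctop, hcheight⟩ := exists_openCollarData_of_bdf b hρs hρ0 hρb hreg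
  -- a point of `N` (the collar point at height `1`) and connectedness of `N` (interior of `X`)
  have hje : Topology.IsEmbedding j := hj.isEmbedding
  obtain ⟨y₀⟩ := hMne
  have h1mem : (1 : ℝ) ∈ Ico (0 : ℝ) c.top := ⟨zero_le_one, c.one_lt_top⟩
  have hq : c.toFun y₀ 1 ∈ range j := by
    rw [hjr, ← ModelWithCorners.compl_boundary]
    intro hb'
    have h0 : ρ (c.toFun y₀ 1) = 0 := (hρb _).2 hb'
    have hh := c.height_apply y₀ 1 h1mem
    rw [hcheight, h0, zero_mul] at hh
    exact zero_ne_one hh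
  obtain ⟨p, -⟩ := hq
  haveI : Nonempty N := ⟨p⟩
  haveI : ConnectedSpace N := by
    have hpre : IsPreconnected ((𝓡∂ 5).interior X) :=
      Summit.SmoothPoincare4.SmoothPoincare4.Cruxes.AhHadamardFilling.EinsteinBulkTransfer.stub_interiorConnected
        X
    rw [← hjr, ← image_univ, hje.isInducing.isPreconnected_image] at hpre
    exact { isPreconnected_univ := hpre, toNonempty := inferInstance }
  -- the GGSU corollary with abstract convexity input, at `m = 3`, `k = 2`, `B = M`
  exact boundary_sphere_of_convex_of_nonTrapping_of_nonpos (m := 3) g gb hj hjr hι hιr hρs hρ0 hρb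
    hν hconf hε₀ hconv hNT' hsec

/-- **`EinsteinHadamardFillingStandard` (the crux, item stmt-SmoothPoincare4-7999) from the two pieces**:
the Einstein equation is simply not used (`hadamardFillingStandard_of_pieces`). This is the glue of
the split `HadamardFillingNonTrapping → CompactificationConvexNearInfinity → EinsteinHadamardFillingStandard`
(hypotheses here in the order convexity, non-trapping). [cite: GrahamEtAl2020, Prop. 5.13] -/
theorem einsteinHadamardFillingStandard_of_pieces
    (hconvex : ∀ (N : Type) [TopologicalSpace N] [T2Space N] [SecondCountableTopology N]
      [ChartedSpace (EuclideanSpace ℝ (Fin 5)) N] [IsManifold (𝓡 5) ∞ N]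
      (g : Bundle.ContMDiffRiemannianMetric (𝓡 5) ∞ (EuclideanSpace ℝ (Fin 5))
        (TangentSpace (𝓡 5) : N → Type _))
      [(Literature.Geometry.Lorentzian.PseudoRiemannianMetric.ofRiemannian g).HasLeviCivita]
      (X : Type) [TopologicalSpace X] [T2Space X] [SecondCountableTopology X]
      [ChartedSpace (EuclideanHalfSpace 5) X] [IsManifold (𝓡∂ 5) ∞ X] [CompactSpace X]
      (j : N → X) (ρ : X → ℝ)
      (gb : Bundle.ContMDiffRiemannianMetric (𝓡∂ 5) 2 (EuclideanSpace ℝ (Fin 5))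
        (TangentSpace (𝓡∂ 5) : X → Type _)),
      Manifold.IsSmoothEmbedding (𝓡 5) (𝓡∂ 5) ∞ j → Set.range j = (𝓡∂ 5).interior X →
      ContMDiff (𝓡∂ 5) 𝓘(ℝ, ℝ) ∞ ρ → (∀ x : X, 0 ≤ ρ x) →
      (∀ x : X, ρ x = 0 ↔ x ∈ (𝓡∂ 5).boundary X) →
      (∀ z : X, z ∈ (𝓡∂ 5).boundary X → ∃ ν : TangentSpace (𝓡∂ 5) z, gb.inner z ν ν = 1 ∧
        ∀ v : TangentSpace (𝓡∂ 5) z, gb.inner z ν v = mfderiv (𝓡∂ 5) 𝓘(ℝ, ℝ) ρ z v) →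
      (∀ (x : N) (v w : TangentSpace (𝓡 5) x),
        gb.inner (j x) (mfderiv (𝓡 5) (𝓡∂ 5) j x v) (mfderiv (𝓡 5) (𝓡∂ 5) j x w) =
          ρ (j x) ^ 2 * g.inner x v w) →
      ∃ ε₀ : ℝ, 0 < ε₀ ∧ ∀ γ : ℝ → N,
        Literature.Geometry.Lorentzian.IsGeodesic
          (Literature.Geometry.Lorentzian.PseudoRiemannianMetric.ofRiemannian g).leviCivita γ →
        ∀ t₀ : ℝ, g.inner (γ t₀) (Literature.Geometry.Lorentzian.velocity (𝓡 5) γ t₀)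
            (Literature.Geometry.Lorentzian.velocity (𝓡 5) γ t₀) = 1 →
          ρ (j (γ t₀)) < ε₀ → deriv (fun t ↦ ρ (j (γ t))) t₀ = 0 →
          deriv (deriv fun t ↦ ρ (j (γ t))) t₀ < 0)
    (hNT : ∀ (M : Type) [TopologicalSpace M] [T2Space M] [SecondCountableTopology M]
      [ChartedSpace (EuclideanSpace ℝ (Fin 4)) M] [IsManifold (𝓡 4) ∞ M] [CompactSpace M],
      M ≃ₕ Metric.sphere (0 : EuclideanSpace ℝ (Fin 5)) 1 →
      ∀ (N : Type) [TopologicalSpace N] [T2Space N] [SecondCountableTopology N]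
        [ChartedSpace (EuclideanSpace ℝ (Fin 5)) N] [IsManifold (𝓡 5) ∞ N]
        (g : Bundle.ContMDiffRiemannianMetric (𝓡 5) ∞ (EuclideanSpace ℝ (Fin 5))
          (TangentSpace (𝓡 5) : N → Type _))
        [(Literature.Geometry.Lorentzian.PseudoRiemannianMetric.ofRiemannian g).HasLeviCivita],
        (∃ (X : Type) (_ : TopologicalSpace X) (_ : T2Space X) (_ : SecondCountableTopology X)
            (_ : ChartedSpace (EuclideanHalfSpace 5) X) (_ : IsManifold (𝓡∂ 5) ∞ X)
            (_ : CompactSpace X) (_ : ConnectedSpace X) (j : N → X) (ι : M → X) (ρ : X → ℝ)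
            (gb : Bundle.ContMDiffRiemannianMetric (𝓡∂ 5) 2 (EuclideanSpace ℝ (Fin 5))
              (TangentSpace (𝓡∂ 5) : X → Type _)),
            Manifold.IsSmoothEmbedding (𝓡 5) (𝓡∂ 5) ∞ j ∧ Set.range j = (𝓡∂ 5).interior X ∧
            Manifold.IsSmoothEmbedding (𝓡 4) (𝓡∂ 5) ∞ ι ∧ Set.range ι = (𝓡∂ 5).boundary X ∧
            ContMDiff (𝓡∂ 5) 𝓘(ℝ, ℝ) ∞ ρ ∧ (∀ x : X, 0 ≤ ρ x) ∧
            (∀ x : X, ρ x = 0 ↔ x ∈ (𝓡∂ 5).boundary X) ∧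
            (∀ y : M, ∃ ν : TangentSpace (𝓡∂ 5) (ι y), gb.inner (ι y) ν ν = 1 ∧
              ∀ v : TangentSpace (𝓡∂ 5) (ι y),
                gb.inner (ι y) ν v = mfderiv (𝓡∂ 5) 𝓘(ℝ, ℝ) ρ (ι y) v) ∧
            (∀ (x : N) (v w : TangentSpace (𝓡 5) x),
              gb.inner (j x) (mfderiv (𝓡 5) (𝓡∂ 5) j x v) (mfderiv (𝓡 5) (𝓡∂ 5) j x w) =
                ρ (j x) ^ 2 * g.inner x v w)) →
        (∀ (x : N) (X Y : TangentSpace (𝓡 5) x), g.inner x X X = 1 → g.inner x Y Y = 1 →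
            g.inner x X Y = 0 →
            (Literature.Geometry.Lorentzian.PseudoRiemannianMetric.ofRiemannian g).curvatureForm
              (Literature.Geometry.Lorentzian.PseudoRiemannianMetric.ofRiemannian g).leviCivita
                x X Y Y X ≤ 0) →
        ∀ γ : ℝ → N,
          Literature.Geometry.Lorentzian.IsGeodesic
            (Literature.Geometry.Lorentzian.PseudoRiemannianMetric.ofRiemannian g).leviCivita γ →
          Literature.Geometry.Lorentzian.velocity (𝓡 5) γ 0 ≠ 0 →
          ∀ K : Set N, IsCompact K → ∃ T : ℝ, ∀ t : ℝ, T ≤ t → γ t ∉ K) :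
    _root_.Summit.SmoothPoincare4.SmoothPoincare4.Theses.EinsteinBulk.EinsteinHadamardFillingStandard :=
  fun M _ _ _ _ _ _ _ _ _ he g₀ N _ _ _ _ _ g _ _ hpack hsec ↦
    hadamardFillingStandard_of_pieces hconvex hNT M he g₀ N g hpack hsec

/-- **The registered glue item `EinsteinBulk.EinsteinHadamardFillingStandardOfPieces`
(stmt-SmoothPoincare4-17740: `CompactificationConvexNearInfinity → HadamardFillingNonTrapping →
EinsteinHadamardFillingStandard`, route items stmt-SmoothPoincare4-17732, -17728, -7999), BY NAME.**
[cite: GrahamEtAl2020, Prop. 5.13] -/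
theorem einsteinHadamardFillingStandardOfPieces_proof :
    _root_.Summit.SmoothPoincare4.SmoothPoincare4.Theses.EinsteinBulk.EinsteinHadamardFillingStandardOfPieces :=
  einsteinHadamardFillingStandard_of_pieces

end Summit.SmoothPoincare4.SmoothPoincare4.Cruxes.EinsteinHadamardFillingStandard.GgsuC2Redirect

end
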